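import Literature.InformationTheory.QuantumCodes.ToricCodeErasureThreshold
import Literature.InformationTheory.QuantumCodes.CSSMixedChannelThreshold
import HarnessLib

/-!
# The toric code under LOSSES AND ERRORS: the certified trade-off curve `ν · (y + 2(1-y)√(p(1-p))) < 1`

Topic `Literature/InformationTheory/QuantumCodes` (venture QEC, LADDER-QEC rung Q5; qec-lit-2 gen 3). PROVED, no
named fact, kernel axioms. Stace–Barrett–Doherty (PRL 102 (2009) 200501) studied the toric code under
simultaneous qubit LOSS (rate `y`, heralded) and Pauli errors (rate `p`) and computed the correctable region
numerically. Dumer–Kovalev–Pryadko's Theorem 2 gives a PROVED inner region `(w-1)·Υ_CSS(y,p) < 1`,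
`Υ_CSS = y + 2(1-y)√(p(1-p))`, with `w - 1 = 3` for the toric code (`CSSMixedChannelThreshold.lean`). This
file sharpens the constant for the toric code from `w - 1 = 3` to ANY self-avoiding-walk growth rate `ν` with
`SAWCountBound C ν` (`cₙ(ℤ²) ≤ C νⁿ`), by running the polygon argument of `ToricCodeErasureThreshold.lean` /
`ToricCodeThresholdProof.lean` with DKP15's mixed-channel bad event: a failure of a
minimum-weight-outside-the-erasure decoder forces a homologically non-trivial self-avoiding polygon `P` with
`≥ L` links whose NON-LOST links are at least half faulty (`exists_polygon_of_mixed_failure`); averaging over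
the losses gives `Υ^{|P|}` per polygon (`sum_bernoulliWeight_pow_card_sdiff`), and the walk count sums to
`L² C (νΥ)^L / (ν(1-νΥ))` (`mixedFailureProb_le_of_sawCountBound`). Family form: `mixedThreshold_of_sawCountBound`
— for every `y, p` with `ν Υ_CSS(y,p) < 1`, `Prob_fail → 0`; kernel instance `ν = 3` (`mixedThreshold_three`:
the curve `3(y + 2(1-y)√(p(1-p))) < 1`, interpolating the certified loss threshold `1/3` and error threshold
`p₀(3) ≈ .0286`); Summits tiers `ν = 26^{1/3}`, `ν > μ(ℤ²)` by import.

## References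

* [StaceBarrettDoherty2009] T. M. Stace, S. D. Barrett, A. C. Doherty, PRL 102 (2009) 200501, p. 2–3 (loss +
  computational errors on the toric code; numerically determined correctable region).
* [DumerKovalevPryadko2015] I. Dumer, A. A. Kovalev, L. P. Pryadko, PRL 115 (2015) 050502, Thm 2 and App. A §1.1.
* [DennisEtAl2002] E. Dennis, A. Kitaev, A. Landahl, J. Preskill, J. Math. Phys. 43 (2002) 4452, §5.3 (SAW bound).
-/

namespace Literature.InformationTheory.QuantumCodes

namespace ToricCode

open Finset Matrix Filter Topology
open Literature.Probability.RandomPlanarGeometry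
open Literature.Probability.RandomPlanarGeometry.SAW.Zd

variable {L : ℕ}

/-! ### Failure forces a long polygon, half of whose non-lost links are faulty -/

/-- **Mixed-channel bad event on the toric code.** If a minimum-weight-outside-the-erasure decoder (losses `Er`
known) fails on the error `e` — the net chain is homologically non-trivial — then (`L ≥ 3`) some homologically
non-trivial self-avoiding polygon `P` with `≥ L` links has `|P ∖ Er| ≤ 2 |(P ∖ Er) ∩ supp e|`.
[cite: DumerKovalevPryadko2015, eq. (min-E-condition) with App. A §1.1 ("2b + a − m ≥ 0")] -/
theorem exists_polygon_of_mixed_failure [NeZero L] (hL : 3 ≤ L) {D : ErasureDecoder (Edge L) (Syndrome L)}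
    (hD : D.IsMinWeightOutside (starMatrix L)) {Er : Finset (Edge L)} {e : Chain L}
    (hfail : ¬ D.Corrects (fun e => starMatrix L *ᵥ e) (boundaries L) Er e) :
    ∃ (v : Vertex L) (w : List (Fin 2 × Bool)), IsPolygon v w ∧ L ≤ w.length ∧
      (polygonEdges v w \ Er).card ≤ 2 * ((polygonEdges v w \ Er) ∩ supp e).card := by
  classical
  have hsyn : starMatrix L *ᵥ D Er (starMatrix L *ᵥ e) = starMatrix L *ᵥ e := (hD Er e).1
  have hmin := (hD Er e).2
  set x : Chain L := D Er (starMatrix L *ᵥ e) + e with hxdef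
  have hx : x ∈ cycles L := by
    change starMatrix L *ᵥ x = 0
    rw [hxdef, Matrix.mulVec_add, hsyn]
    funext i
    exact CharTwo.add_self_eq_zero _
  have hxb : x ∉ boundaries L := hfail
  obtain ⟨v, w, hP, hsub, hq⟩ := exists_polygon_not_mem_boundaries hL hx hxb
  refine ⟨v, w, hP, ?_, ?_⟩
  · have h := cycle_weight_ge_holds L (polygonChain v w) (polygonChain_mem_cycles hP.closed) hq
    rwa [hammingNorm_polygonChain hP] at h
  · have hU : IsUndetectable (starMatrix L) (polygonEdges v w) := by
      rw [← supp_polygonChain hP.edgeAt_injOn, isUndetectable_supp_iff]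
      exact polygonChain_mem_cycles hP.closed
    have hW : polygonEdges v w ⊆ supp (e + D Er (starMatrix L *ᵥ e)) := by rwa [add_comm]
    exact card_sdiff_le_two_mul_of_minWeightOutside (starMatrix L) hsyn hmin hW hU

/-! ### The counting bound -/

/-- The walk-count hypothesis bounds the number of self-avoiding step words. [cite: DennisEtAl2002, §5.3 eq. (29)] -/
private theorem card_sawWords_le'' {C ν : ℝ} (h : SAWCountBound C ν) (n : ℕ) :
    ((Word.sawWords 2 n).card : ℝ) ≤ C * ν ^ n := by
  rw [Word.card_sawWords, SAW.Zd.count_two]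
  exact h n

/-- The walk-count constant is non-negative. [cite: DennisEtAl2002, §5.3 eq. (29)] -/
private theorem nonneg_of_sawCountBound'' {C ν : ℝ} (h : SAWCountBound C ν) : 0 ≤ C := by
  have h0 := h 0
  rw [SAW.count_zero, pow_zero, mul_one, Nat.cast_one] at h0
  linarith

/-- **The polygon sum** `Σ_{P polygon, |P| ≥ L} θ^{|P|} ≤ L² C (νθ)^L / (ν(1 - νθ))` under `SAWCountBound C ν`
(`θ ≥ 0`, `νθ < 1`, `L ≥ 3`). [cite: DennisEtAl2002, §5.3 eqs. (saw_prob), (saw_L), (threshold_2d)] -/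
theorem sum_pow_card_polygon_le {C ν : ℝ} (hν : 0 < ν) (hC : SAWCountBound C ν) (L : ℕ) [NeZero L]
    (hL : 3 ≤ L) {θ : ℝ} (hθ0 : 0 ≤ θ) (hr : ν * θ < 1) (Ps : Finset (Finset (Edge L)))
    (hPs : ∀ P ∈ Ps, (∃ (v : Vertex L) (w : List (Fin 2 × Bool)), IsPolygon v w ∧ polygonEdges v w = P) ∧
      L ≤ P.card) :
    ∑ P ∈ Ps, θ ^ P.card ≤ (L : ℝ) ^ 2 * C * (ν * θ) ^ L / (ν * (1 - ν * θ)) := by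
  classical
  set r : ℝ := ν * θ with hrdef
  have hr0 : 0 ≤ r := by positivity
  have h1r : 0 < 1 - r := by linarith
  have hC0 : 0 ≤ C := nonneg_of_sawCountBound'' hC
  set M := Fintype.card (Edge L) with hM
  have hmaps : ∀ P ∈ Ps, P.card ∈ Finset.Ico L (M + 1) := by
    intro P hP
    rw [Finset.mem_Ico]
    exact ⟨(hPs P hP).2, Nat.lt_succ_of_le (card_le_univ P)⟩
  have h2 : ∑ P ∈ Ps, θ ^ P.card =
      ∑ H ∈ Finset.Ico L (M + 1), ∑ P ∈ Ps.filter (fun P => P.card = H), θ ^ P.card :=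
    (Finset.sum_fiberwise_of_maps_to hmaps _).symm
  have hfiber : ∀ H ∈ Finset.Ico L (M + 1),
      ∑ P ∈ Ps.filter (fun P => P.card = H), θ ^ P.card ≤ (L : ℝ) ^ 2 * (C * ν ^ (H - 1)) * θ ^ H := by
    intro H _
    have hcount : ((Ps.filter (fun P => P.card = H)).card : ℝ) ≤ (L : ℝ) ^ 2 * (C * ν ^ (H - 1)) := by
      have hc := card_polygons_le hL H (Ps.filter (fun P => P.card = H)) (by
        intro P hP
        rw [mem_filter] at hP
        obtain ⟨⟨v, w, hPw, rfl⟩, -⟩ := hPs P hP.1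
        exact ⟨v, w, hPw, by rw [← hP.2, hPw.card_polygonEdges], rfl⟩)
      calc ((Ps.filter (fun P => P.card = H)).card : ℝ)
          ≤ ((L ^ 2 * (Word.sawWords 2 (H - 1)).card : ℕ) : ℝ) := by exact_mod_cast hc
        _ = (L : ℝ) ^ 2 * ((Word.sawWords 2 (H - 1)).card : ℝ) := by push_cast; ring
        _ ≤ (L : ℝ) ^ 2 * (C * ν ^ (H - 1)) :=
            mul_le_mul_of_nonneg_left (card_sawWords_le'' hC (H - 1)) (by positivity)
    calc ∑ P ∈ Ps.filter (fun P => P.card = H), θ ^ P.card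
        = ∑ P ∈ Ps.filter (fun P => P.card = H), θ ^ H :=
          Finset.sum_congr rfl fun P hP => by rw [(Finset.mem_filter.1 hP).2]
      _ = ((Ps.filter (fun P => P.card = H)).card : ℝ) * θ ^ H := by
          rw [Finset.sum_const, nsmul_eq_mul]
      _ ≤ (L : ℝ) ^ 2 * (C * ν ^ (H - 1)) * θ ^ H :=
          mul_le_mul_of_nonneg_right hcount (pow_nonneg hθ0 _)
  have hterm : ∀ H ∈ Finset.Ico L (M + 1),
      (L : ℝ) ^ 2 * (C * ν ^ (H - 1)) * θ ^ H = (L : ℝ) ^ 2 * C / ν * r ^ H := by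
    intro H hH
    have hH1 : 1 ≤ H := le_trans (by omega : 1 ≤ L) (Finset.mem_Ico.1 hH).1
    obtain ⟨H', rfl⟩ : ∃ H', H = H' + 1 := ⟨H - 1, by omega⟩
    simp only [Nat.add_sub_cancel, hrdef]
    field_simp
    ring
  have h3 : ∑ H ∈ Finset.Ico L (M + 1), (L : ℝ) ^ 2 * (C * ν ^ (H - 1)) * θ ^ H =
      (L : ℝ) ^ 2 * C / ν * ∑ H ∈ Finset.Ico L (M + 1), r ^ H := by
    rw [Finset.mul_sum]
    exact Finset.sum_congr rfl hterm
  have hgeom := geom_tail_le hr0 hr L (M + 1)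
  calc ∑ P ∈ Ps, θ ^ P.card
      = ∑ H ∈ Finset.Ico L (M + 1), ∑ P ∈ Ps.filter (fun P => P.card = H), θ ^ P.card := h2
    _ ≤ ∑ H ∈ Finset.Ico L (M + 1), (L : ℝ) ^ 2 * (C * ν ^ (H - 1)) * θ ^ H := Finset.sum_le_sum hfiber
    _ = (L : ℝ) ^ 2 * C / ν * ∑ H ∈ Finset.Ico L (M + 1), r ^ H := h3
    _ ≤ (L : ℝ) ^ 2 * C / ν * (r ^ L / (1 - r)) := mul_le_mul_of_nonneg_left hgeom (by positivity)
    _ = (L : ℝ) ^ 2 * C * r ^ L / (ν * (1 - r)) := by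
        field_simp

/-- **Finite-size mixed-channel bound for the toric code** (losses `y` AND errors `p`; minimum-weight decoding
outside the known losses): under `SAWCountBound C ν`, `L ≥ 3`, `0 ≤ y ≤ 1`, `0 ≤ p ≤ 1/2` and
`ν·Υ_CSS(y,p) < 1`: `Prob_fail ≤ L² C (νΥ)^L / (ν (1 - νΥ))`.
[cite: DumerKovalevPryadko2015, Thm 2 with App. A §1.1 (here with the SAW count of DennisEtAl2002 §5.3 in place of (w−1)^{m−1})] -/
theorem mixedFailureProb_le_of_sawCountBound {C ν : ℝ} (hν : 0 < ν) (hC : SAWCountBound C ν)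
    (L : ℕ) [NeZero L] (hL : 3 ≤ L) {D : ErasureDecoder (Edge L) (Syndrome L)}
    (hD : D.IsMinWeightOutside (starMatrix L)) {y p : ℝ} (hy0 : 0 ≤ y) (hy1 : y ≤ 1)
    (hp0 : 0 ≤ p) (hp : p ≤ 1 / 2) (hr : ν * upsilonCSS y p < 1) :
    mixedFailureProb (starMatrix L) (boundaries L) D y p ≤
      (L : ℝ) ^ 2 * C * (ν * upsilonCSS y p) ^ L / (ν * (1 - ν * upsilonCSS y p)) := by
  classical
  set s : ℝ := Real.sqrt (p * (1 - p)) with hs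
  have hs0 : 0 ≤ s := Real.sqrt_nonneg _
  have hΥ : upsilonCSS y p = y + (1 - y) * (2 * s) := by rw [upsilonCSS, hs]; ring
  have hΥ0 : 0 ≤ upsilonCSS y p := by rw [hΥ]; nlinarith
  set Ps : Finset (Finset (Edge L)) := univ.filter (fun P =>
    (∃ (v : Vertex L) (w : List (Fin 2 × Bool)), IsPolygon v w ∧ polygonEdges v w = P) ∧ L ≤ P.card)
    with hPsdef
  have hPs : ∀ P ∈ Ps, (∃ (v : Vertex L) (w : List (Fin 2 × Bool)), IsPolygon v w ∧ polygonEdges v w = P) ∧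
      L ≤ P.card := fun P hP => (mem_filter.1 hP).2
  -- Step 1: inner sums covered by the polygon bad events
  have hinner : ∀ Er : Finset (Edge L),
      ∑ E ∈ univ.filter (fun E : Finset (Edge L) => ∃ e : Chain L, supp e \ Er = E \ Er ∧
          ¬ D.Corrects (fun e => starMatrix L *ᵥ e) (boundaries L) Er e), bernoulliWeight p E ≤
        ∑ P ∈ Ps, (2 * s) ^ (P \ Er).card := by
    intro Er
    refine sum_bernoulliWeight_le_of_cover hp0 hp Ps (fun P : Finset (Edge L) => P \ Er) _ fun E hE => ?_
    rw [mem_filter] at hE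
    obtain ⟨e, heE, hfail⟩ := hE.2
    obtain ⟨v, w, hP, hLw, hhalf⟩ := exists_polygon_of_mixed_failure hL hD hfail
    refine ⟨polygonEdges v w, ?_, ?_⟩
    · rw [hPsdef, mem_filter]
      refine ⟨mem_univ _, ⟨v, w, hP, rfl⟩, ?_⟩
      rw [hP.card_polygonEdges]
      exact hLw
    · have hsame : (polygonEdges v w \ Er) ∩ supp e = (polygonEdges v w \ Er) ∩ E := by
        ext q
        simp only [Finset.mem_inter, Finset.mem_sdiff]
        constructor
        · rintro ⟨⟨hqW, hqEr⟩, hqe⟩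
          have : q ∈ supp e \ Er := Finset.mem_sdiff.2 ⟨hqe, hqEr⟩
          rw [heE] at this
          exact ⟨⟨hqW, hqEr⟩, (Finset.mem_sdiff.1 this).1⟩
        · rintro ⟨⟨hqW, hqEr⟩, hqE⟩
          have : q ∈ E \ Er := Finset.mem_sdiff.2 ⟨hqE, hqEr⟩
          rw [← heE] at this
          exact ⟨⟨hqW, hqEr⟩, (Finset.mem_sdiff.1 this).1⟩
      rw [← hsame]
      exact hhalf
  -- Step 2: average over the losses, swap, binomial identity
  have hnn : ∀ Er : Finset (Edge L), 0 ≤ bernoulliWeight y Er := bernoulliWeight_nonneg hy0 hy1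
  have h2 : mixedFailureProb (starMatrix L) (boundaries L) D y p ≤
      ∑ Er : Finset (Edge L), bernoulliWeight y Er * ∑ P ∈ Ps, (2 * s) ^ (P \ Er).card := by
    unfold mixedFailureProb
    exact Finset.sum_le_sum fun Er _ => mul_le_mul_of_nonneg_left (hinner Er) (hnn Er)
  have h3 : ∑ Er : Finset (Edge L), bernoulliWeight y Er * ∑ P ∈ Ps, (2 * s) ^ (P \ Er).card =
      ∑ P ∈ Ps, upsilonCSS y p ^ P.card := by
    simp_rw [Finset.mul_sum]
    rw [Finset.sum_comm]
    refine Finset.sum_congr rfl fun P _ => ?_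
    rw [sum_bernoulliWeight_pow_card_sdiff, hΥ]
  -- Step 3: the self-avoiding-walk count
  have h4 := sum_pow_card_polygon_le hν hC L hL hΥ0 hr Ps hPs
  exact h2.trans (h3.le.trans h4)

/-! ### The threshold curve -/

/-- The failure probabilities of a family of loss-aware decoders `D L` of the `(L+1) × (L+1)` toric codes under
losses of rate `y` and errors of rate `p`. [cite: StaceBarrettDoherty2009, p. 2 (loss and computational errors)] -/
noncomputable def mixedFamily (D : (L : ℕ) → ErasureDecoder (Edge (L + 1)) (Syndrome (L + 1))) (y : ℝ) :
    ℕ → ℝ → ℝ :=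
  fun L p => mixedFailureProb (starMatrix (L + 1)) (boundaries (L + 1)) (D L) y p

/-- **Certified loss–error trade-off for the toric code**: under `SAWCountBound C ν` (`ν ≥ 1`), for EVERY family
of minimum-weight-outside-the-losses decoders and every `(y, p)` with `0 ≤ y ≤ 1`, `0 ≤ p ≤ 1/2` and
`ν · (y + 2(1-y)√(p(1-p))) < 1`, the failure probability tends to `0`.
[cite: DumerKovalevPryadko2015, Thm 2 (with the SAW count ν in place of w − 1)] -/
theorem mixedThreshold_of_sawCountBound {C ν : ℝ} (hν : 1 ≤ ν) (hC : SAWCountBound C ν)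
    (D : (L : ℕ) → ErasureDecoder (Edge (L + 1)) (Syndrome (L + 1)))
    (hD : ∀ L, (D L).IsMinWeightOutside (starMatrix (L + 1)))
    {y p : ℝ} (hy0 : 0 ≤ y) (hy1 : y ≤ 1) (hp0 : 0 ≤ p) (hp : p ≤ 1 / 2) (hr : ν * upsilonCSS y p < 1) :
    Tendsto (fun L => mixedFamily D y L p) atTop (𝓝 0) := by
  have hν0 : 0 < ν := by linarith
  set r : ℝ := ν * upsilonCSS y p with hrdef
  have hΥ0 : 0 ≤ upsilonCSS y p := by
    unfold upsilonCSS
    have := Real.sqrt_nonneg (p * (1 - p))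
    nlinarith
  have hr0 : 0 ≤ r := by positivity
  have h1r : 0 < 1 - r := by linarith
  have hC0 : 0 ≤ C := nonneg_of_sawCountBound'' hC
  have hp1 : p ≤ 1 := by linarith
  have hbound : ∀ L : ℕ, 2 ≤ L →
      mixedFamily D y L p ≤ ((L + 1 : ℕ) : ℝ) ^ 2 * C * r ^ (L + 1) / (ν * (1 - r)) := by
    intro L hL2
    exact mixedFailureProb_le_of_sawCountBound hν0 hC (L + 1) (by omega) (hD L) hy0 hy1 hp0 hp hr
  have hnonneg : ∀ L : ℕ, 0 ≤ mixedFamily D y L p := by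
    intro L
    unfold mixedFamily mixedFailureProb
    exact Finset.sum_nonneg fun Er _ => mul_nonneg (bernoulliWeight_nonneg hy0 hy1 _)
      (Finset.sum_nonneg fun E _ => bernoulliWeight_nonneg hp0 hp1 _)
  have hlim : Tendsto (fun L : ℕ => ((L + 1 : ℕ) : ℝ) ^ 2 * C * r ^ (L + 1) / (ν * (1 - r)))
      atTop (𝓝 0) := by
    have h0 := tendsto_pow_const_mul_const_pow_of_abs_lt_one 2 (show |r| < 1 by rwa [abs_of_nonneg hr0])
    have h1 : Tendsto (fun L : ℕ => ((L + 1 : ℕ) : ℝ) ^ 2 * r ^ (L + 1)) atTop (𝓝 0) :=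
      (Filter.tendsto_add_atTop_iff_nat 1).2 h0
    have h2 := h1.const_mul (C / (ν * (1 - r)))
    rw [mul_zero] at h2
    refine h2.congr fun L => ?_
    have hν0' : ν ≠ 0 := hν0.ne'
    have h1r0 : 1 - r ≠ 0 := h1r.ne'
    field_simp
  refine squeeze_zero' (Filter.Eventually.of_forall hnonneg) ?_ hlim
  rw [Filter.eventually_atTop]
  exact ⟨2, fun L hL => hbound L hL⟩

/-- The elementary count `cₙ ≤ (4/3)·3ⁿ`. [cite: DennisEtAl2002, §5.3 eq. (saw_d) (d = 2)] -/
private theorem sawCountBound_three'' : SAWCountBound (4 / 3) 3 := by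
  intro n
  rw [← SAW.Zd.count_two]
  cases n with
  | zero =>
    rw [SAW.Zd.count_zero]
    norm_num
  | succ n =>
    have h := SAW.Zd.count_succ_le 2 n
    have h' : (SAW.Zd.count 2 (n + 1) : ℝ) ≤ 4 * 3 ^ n := by exact_mod_cast h
    calc (SAW.Zd.count 2 (n + 1) : ℝ) ≤ 4 * 3 ^ n := h'
      _ = 4 / 3 * 3 ^ (n + 1) := by ring

/-- **Kernel instance `ν = 3`**: the certified region `3·(y + 2(1-y)√(p(1-p))) < 1` — interpolating the loss
threshold `1/3` (`p = 0`) and the error threshold `p₀(3)` (`y = 0`) — for every family of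
minimum-weight-outside-the-losses decoders of the toric codes. UNCONDITIONAL.
[cite: StaceBarrettDoherty2009, p. 3 (the correctable region in the (p_loss, p_err) plane)] -/
theorem mixedThreshold_three (D : (L : ℕ) → ErasureDecoder (Edge (L + 1)) (Syndrome (L + 1)))
    (hD : ∀ L, (D L).IsMinWeightOutside (starMatrix (L + 1)))
    {y p : ℝ} (hy0 : 0 ≤ y) (hy1 : y ≤ 1) (hp0 : 0 ≤ p) (hp : p ≤ 1 / 2) (hr : 3 * upsilonCSS y p < 1) :
    Tendsto (fun L => mixedFamily D y L p) atTop (𝓝 0) :=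
  mixedThreshold_of_sawCountBound (by norm_num) sawCountBound_three'' D hD hy0 hy1 hp0 hp hr

/-- **Non-vacuity**: the canonical minimum-weight-outside-the-losses decoder of the toric code qualifies.
[cite: DumerKovalevPryadko2015, p. 3 (exhaustive search decoder)] -/
theorem minWeightOutside_isMinWeightOutside_toric (L : ℕ) [NeZero L] :
    (ErasureDecoder.minWeightOutside (starMatrix L)).IsMinWeightOutside (starMatrix L) :=
  ErasureDecoder.minWeightOutside_isMinWeightOutside (starMatrix L)

end ToricCode

end Literature.InformationTheory.QuantumCodes
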